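import Mathlib.LinearAlgebra.Matrix.PosDef

/-!
# `HonestZwanzig.RobinCoercivity`, line LinAlg — stub `stub_gramDuality` (Gram duality)

Support file (`--supports` the crux `RobinCoercivity`, stmt-AtomisticToContinuum-12695, of route
`HonestZwanzig`, sub-problem `FouriersLaw`): the polar-decomposition / Gram-duality step of card
gradient-gram-schur-test, in inverse-free "flux form". Pure finite-dimensional linear algebra over `ℝ`.

If `G, χ` are positive definite `n × n` real matrices, `B` is an `m × n` real matrix and the quadratic
form of `G` is bounded on every charge/flux pair, `aᵀ G a ≤ K |w|²` whenever `χ a = Bᵀ w`, then the Schur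
complement `χ G⁻¹ χ` is Robin-coercive: `K⁻¹ |B ξ|² ≤ (χ ξ)ᵀ G⁻¹ (χ ξ)` for every `ξ`.

Proof (one completed square). Fix `ξ`, put `w := B ξ`, `a := χ⁻¹ Bᵀ w` (so `χ a = Bᵀ w`) and
`η := G⁻¹ χ ξ` (so `G η = χ ξ`). Then `aᵀ G η = aᵀ χ ξ = (χ a)ᵀ ξ = (Bᵀ w)ᵀ ξ = |w|²`,
`ηᵀ G η = (χ ξ)ᵀ G⁻¹ (χ ξ)`, and `0 ≤ (K⁻¹ a − η)ᵀ G (K⁻¹ a − η) = K⁻² aᵀGa − 2 K⁻¹ |w|² + ηᵀ G η`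
together with the hypothesis `aᵀ G a ≤ K |w|²` give the claim. [folklore]
-/

namespace Summit.AtomisticToContinuum.FouriersLaw.Theorems.HonestZwanzig.Robin

open Matrix

/-- A real positive definite matrix is symmetric: `Gᵀ = G`. [folklore] -/
private theorem transpose_eq_of_posDef {n : Type*} [Fintype n] {G : Matrix n n ℝ} (hG : G.PosDef) :
    Gᵀ = G := by
  have h := hG.isHermitian
  rwa [Matrix.IsHermitian, Matrix.conjTranspose_eq_transpose_of_trivial] at h

/-- For a real positive definite (hence symmetric) matrix, `v ⬝ᵥ (G *ᵥ u) = (G *ᵥ v) ⬝ᵥ u`.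
[folklore] -/
private theorem dotProduct_mulVec_of_posDef {n : Type*} [Fintype n] {G : Matrix n n ℝ}
    (hG : G.PosDef) (v u : n → ℝ) : v ⬝ᵥ (G *ᵥ u) = (G *ᵥ v) ⬝ᵥ u := by
  rw [dotProduct_mulVec, ← Matrix.mulVec_transpose, transpose_eq_of_posDef hG]

/-- **Gram duality** (polar decomposition, one completed square): pure matrix algebra. If
`aᵀGa ≤ K|w|²` whenever `χa = Bᵀw`, then `K⁻¹ |Bξ|² ≤ (χξ)ᵀ G⁻¹ (χξ)` for every `ξ`
(`G, χ` positive definite). [folklore] -/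
theorem stub_gramDuality {m n : Type*} [Fintype m] [Fintype n] [DecidableEq n]
    (B : Matrix m n ℝ) (G χ : Matrix n n ℝ) (hG : G.PosDef) (hχ : χ.PosDef) {K : ℝ} (hK : 0 < K)
    (h : ∀ (a : n → ℝ) (w : m → ℝ), χ *ᵥ a = Bᵀ *ᵥ w → a ⬝ᵥ (G *ᵥ a) ≤ K * (w ⬝ᵥ w))
    (ξ : n → ℝ) :
    K⁻¹ * ((B *ᵥ ξ) ⬝ᵥ (B *ᵥ ξ)) ≤ (χ *ᵥ ξ) ⬝ᵥ (G⁻¹ *ᵥ (χ *ᵥ ξ)) := by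
  -- invertibility of `G` and `χ`
  have hGdet : IsUnit G.det := (Matrix.isUnit_iff_isUnit_det G).mp hG.isUnit
  have hχdet : IsUnit χ.det := (Matrix.isUnit_iff_isUnit_det χ).mp hχ.isUnit
  -- the flux, the charge potential and the dual test vector
  set w : m → ℝ := B *ᵥ ξ with hw
  set a : n → ℝ := χ⁻¹ *ᵥ (Bᵀ *ᵥ w) with ha
  set η : n → ℝ := G⁻¹ *ᵥ (χ *ᵥ ξ) with hη
  have hχa : χ *ᵥ a = Bᵀ *ᵥ w := by
    rw [ha, Matrix.mulVec_mulVec, Matrix.mul_nonsing_inv _ hχdet, Matrix.one_mulVec]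
  have hGη : G *ᵥ η = χ *ᵥ ξ := by
    rw [hη, Matrix.mulVec_mulVec, Matrix.mul_nonsing_inv _ hGdet, Matrix.one_mulVec]
  -- the hypothesis on the pair `(a, w)`
  have hbound : a ⬝ᵥ (G *ᵥ a) ≤ K * (w ⬝ᵥ w) := h a w hχa
  -- the cross term `aᵀ G η = |w|²`
  have hcross : a ⬝ᵥ (G *ᵥ η) = w ⬝ᵥ w := by
    rw [hGη, dotProduct_mulVec_of_posDef hχ, hχa, Matrix.mulVec_transpose, ← dotProduct_mulVec,
      dotProduct_comm]
  have hcross' : η ⬝ᵥ (G *ᵥ a) = w ⬝ᵥ w := by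
    rw [dotProduct_mulVec_of_posDef hG, dotProduct_comm, hcross]
  -- the diagonal term `ηᵀ G η = (χξ)ᵀ G⁻¹ (χξ)`
  have hdiag : η ⬝ᵥ (G *ᵥ η) = (χ *ᵥ ξ) ⬝ᵥ (G⁻¹ *ᵥ (χ *ᵥ ξ)) := by
    rw [hGη, hη, dotProduct_comm]
  -- positivity of the completed square
  have hpos : 0 ≤ (K⁻¹ • a - η) ⬝ᵥ (G *ᵥ (K⁻¹ • a - η)) := by
    have := hG.posSemidef.dotProduct_mulVec_nonneg (K⁻¹ • a - η)
    rwa [star_trivial] at this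
  have hexp : (K⁻¹ • a - η) ⬝ᵥ (G *ᵥ (K⁻¹ • a - η)) =
      K⁻¹ * K⁻¹ * (a ⬝ᵥ (G *ᵥ a)) - K⁻¹ * (a ⬝ᵥ (G *ᵥ η)) - K⁻¹ * (η ⬝ᵥ (G *ᵥ a)) +
        η ⬝ᵥ (G *ᵥ η) := by
    simp only [Matrix.mulVec_sub, Matrix.mulVec_smul, dotProduct_sub, sub_dotProduct, dotProduct_smul,
      smul_dotProduct, smul_eq_mul]
    ring
  rw [hexp, hcross, hcross', hdiag] at hpos
  -- `K⁻² aᵀGa ≤ K⁻¹ |w|²`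
  have hKi : 0 < K⁻¹ := inv_pos.2 hK
  have hsq : K⁻¹ * K⁻¹ * (a ⬝ᵥ (G *ᵥ a)) ≤ K⁻¹ * (w ⬝ᵥ w) := by
    calc K⁻¹ * K⁻¹ * (a ⬝ᵥ (G *ᵥ a)) ≤ K⁻¹ * K⁻¹ * (K * (w ⬝ᵥ w)) := by
          exact mul_le_mul_of_nonneg_left hbound (mul_nonneg hKi.le hKi.le)
      _ = K⁻¹ * (w ⬝ᵥ w) := by
          field_simp
  linarith

end Summit.AtomisticToContinuum.FouriersLaw.Theorems.HonestZwanzig.Robin
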